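import Mathlib
import Summits.Ventures.HodgeRepro2.T5ConductorUnramifiedPlace

/-!
# §N3.10.3 OUTSIDE `disc K`, IN ONE STATEMENT: UNRAMIFIED, COMMUTATIVE, `k[X]`, AND THE CONDUCTOR OF `ψ_v`

Tier-5 support N3 / §G-N4.2 (seat p3, gen 83). The capstone of files 313–325: for every CM field `K`, every integral
unimodular hermitian `H`, every rational place `v_p` of `ℚ` and every place `v` of `K⁺` above it not containing the
ONE integer `disc K`, ALL the local clauses of §N3.10.3's finiteness argument hold —

* (u1) `e(v/p) = 1`, and every prime `w` of `K` above `v` is prime to `𝔇_{K/K⁺}` and to `𝔇_{K/ℚ}` with `e(w/p) = 1`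
  (file 322);
* (u2) for every continuous non-trivial `ψ : ℚ_p → S¹`, `ψ_v := ψ ∘ Tr_{K⁺_v/ℚ_p}` has the conductor exponent of `ψ`
  (file 325) — with the standard `ψ_p` of conductor exponent `0`, `ψ_v` has conductor `𝒪_v`;
* the record's spherical Hecke algebra `H(U(1 ⊗ H), K_v)` is commutative, and `k[X]` with the Satake chain's
  numerals `q = p^{f(v/p)}` when one prime of `K` lies above `v` (file 322);

and the places containing `disc K` form a finite set. **`record_hecke_conductor_outside_discriminant`**;
**`record_hecke_conductor_outside_discriminant_prime`** — the same above every rational prime `p ∤ disc K`.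
(u3)/(u4), the self-duality of the standard lattice at every place for an integral unimodular `H`, is file 222 /
311 (R1); it is not repeated here.

§8(d): uses an L-value-free non-vanishing device: NO.
-/

open Matrix NumberField NumberField.IsCMField IsDedekindDomain IsDedekindDomain.HeightOneSpectrum Module Polynomial
  Ideal
open scoped TensorProduct Pointwise
open Summit.Ventures.HodgeRepro2.T5UnitaryGroupForm Summit.Ventures.HodgeRepro2.T5UnitaryHeckeAdjoint
  Summit.Ventures.HodgeRepro2.T5HeckePermutationModule Summit.Ventures.HodgeRepro2.T5HeckeDoubleCoset
  Summit.Ventures.HodgeRepro2.T5RecordHyperspecial Summit.Ventures.HodgeRepro2.T5GlobalLatticeAlmostAll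
  Summit.Ventures.HodgeRepro2.T5FinitePlaceSplitClassification Summit.Ventures.HodgeRepro2.T5RecordSatakeIntrinsic
  Summit.Ventures.HodgeRepro2.T5SplitPlaceUnitaryGroup Summit.Ventures.HodgeRepro2.T5NonSplitPlaceUnitaryGroup
  Summit.Ventures.HodgeRepro2.T5FinitePlaceCM Summit.Ventures.HodgeRepro2.T5StarOfInvolution
  Summit.Ventures.HodgeRepro2.T5CyclotomicSubfieldHeckeCommutative
  Summit.Ventures.HodgeRepro2.T5IntegralGramBadSet Summit.Ventures.HodgeRepro2.T5RecordSatakeDifferent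
  Summit.Ventures.HodgeRepro2.T5CyclotomicTwentyOneSatake Summit.Ventures.HodgeRepro2.T5CyclotomicSevenHeckeCommutative
  Summit.Ventures.HodgeRepro2.T5RecordDifferentTower Summit.Ventures.HodgeRepro2.T5RecordUnramifiedEveryCMField
  Summit.Ventures.HodgeRepro2.T5RecordSatakeDiscriminant Summit.Ventures.HodgeRepro2.T5ConductorUnramifiedPlace
  Summit.Ventures.HodgeRepro2.T5AdditiveConductor

namespace Summit.Ventures.HodgeRepro2.T5RecordSatakeConductor

variable (K : Type*) [Field K] [NumberField K] [IsCMField K]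
variable {r : ℕ} (l : Fin r → 𝓞 K) (k : Type*) [Field k] [CharZero k]
  (hl : Submodule.span (𝓞 (maximalRealSubfield K)) (Set.range l) = ⊤)
variable (M : Matrix (Fin 3) (Fin 3) (𝓞 K)) (hM : IsUnit M.det)
  (hH : ((algebraMap (𝓞 K) K).mapMatrix M).IsHermitian)

include hl hM hH in
/-- **§N3.10.3 OUTSIDE `disc K`, IN ONE STATEMENT**: the places of `K⁺` containing `disc K` are finitely many, and at
every place `v` of `K⁺` not containing `disc K`, above the place `v_p` of `ℚ`: (u1) `e(v/p) = 1` and every prime `w`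
of `K` above `v` is prime to both differents with `e(w/p) = 1`; (u2) every continuous non-trivial `ψ : ℚ_p → S¹`
gives `ψ ∘ Tr_{K⁺_v/ℚ_p}` of the same conductor exponent; `H(U(1 ⊗ H), K_v)` is commutative; and if one prime of `K`
lies above `v`, lying over the rational prime `p`, the algebra is `k[X]` and the Satake chain holds with numerals
`q = p^{f(v/p)}`. -/
theorem record_hecke_conductor_outside_discriminant :
    {v : HeightOneSpectrum (𝓞 (maximalRealSubfield K)) |
      ((discr K : ℤ) : 𝓞 (maximalRealSubfield K)) ∈ v.asIdeal}.Finite ∧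
    ∀ v : HeightOneSpectrum (𝓞 (maximalRealSubfield K)),
      ((discr K : ℤ) : 𝓞 (maximalRealSubfield K)) ∉ v.asIdeal →
        v.asIdeal.ramificationIdx ℤ = 1 ∧
        (∀ w : HeightOneSpectrum (𝓞 K), w.asIdeal.LiesOver v.asIdeal →
          ¬ w.asIdeal ∣ differentIdeal (𝓞 (maximalRealSubfield K)) (𝓞 K) ∧
          ¬ w.asIdeal ∣ differentIdeal ℤ (𝓞 K) ∧ w.asIdeal.ramificationIdx ℤ = 1) ∧
        (∀ (vp : HeightOneSpectrum (𝓞 ℚ)) [v.asIdeal.LiesOver vp.asIdeal]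
          (ψ : AddChar (vp.adicCompletion ℚ) Circle), Continuous ψ → (∃ y, ψ y ≠ 1) →
            conductorExp (ψ.compAddMonoidHom
              (Algebra.trace (vp.adicCompletion ℚ) (v.adicCompletion (maximalRealSubfield K))).toAddMonoidHom)
              Valued.v = conductorExp ψ Valued.v) ∧
        RecordCommutative K v l k ((algebraMap (𝓞 K) K).mapMatrix M) ∧
        ((v.asIdeal.primesOver (𝓞 K)).ncard = 1 →
          RecordPolynomial K v l k ((algebraMap (𝓞 K) K).mapMatrix M) ∧
          ∀ (p : ℕ) [Fact p.Prime] [v.asIdeal.LiesOver (span {(p : ℤ)})],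
            ChainNumerals K v l k ((algebraMap (𝓞 K) K).mapMatrix M) (p ^ v.asIdeal.inertiaDeg ℤ)
              ((p ^ v.asIdeal.inertiaDeg ℤ) ^ 3 + 1) ((p ^ v.asIdeal.inertiaDeg ℤ) ^ 4)
              ((p ^ v.asIdeal.inertiaDeg ℤ) ^ 4 + p ^ v.asIdeal.inertiaDeg ℤ)) := by
  obtain ⟨hfin, hmain⟩ := record_hecke_outside_discriminant K l k hl M hM hH
  refine ⟨hfin, fun v hv => ?_⟩
  obtain ⟨h1, h2, h3, h4⟩ := hmain v hv
  refine ⟨h1, h2, fun vp _ ψ hψ hne => ?_, h3, h4⟩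
  exact conductorExp_comp_trace_eq_of_discr_notMem_cm K vp v hv ψ hψ hne

include hl hM hH in
/-- **THE SAME ABOVE EVERY RATIONAL PRIME `p ∤ disc K`**, with the place `v_p` of `ℚ` given. -/
theorem record_hecke_conductor_outside_discriminant_prime (p : ℕ) (hp : ¬ (p : ℤ) ∣ discr K)
    (v : HeightOneSpectrum (𝓞 (maximalRealSubfield K))) [hvp : v.asIdeal.LiesOver (span {(p : ℤ)})]
    (vp : HeightOneSpectrum (𝓞 ℚ)) [v.asIdeal.LiesOver vp.asIdeal] :
    v.asIdeal.ramificationIdx ℤ = 1 ∧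
    (∀ w : HeightOneSpectrum (𝓞 K), w.asIdeal.LiesOver v.asIdeal →
      ¬ w.asIdeal ∣ differentIdeal (𝓞 (maximalRealSubfield K)) (𝓞 K) ∧
      ¬ w.asIdeal ∣ differentIdeal ℤ (𝓞 K) ∧ w.asIdeal.ramificationIdx ℤ = 1) ∧
    (∀ (ψ : AddChar (vp.adicCompletion ℚ) Circle), Continuous ψ → (∃ y, ψ y ≠ 1) →
      conductorExp (ψ.compAddMonoidHom
        (Algebra.trace (vp.adicCompletion ℚ) (v.adicCompletion (maximalRealSubfield K))).toAddMonoidHom)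
        Valued.v = conductorExp ψ Valued.v) ∧
    RecordCommutative K v l k ((algebraMap (𝓞 K) K).mapMatrix M) ∧
    ((v.asIdeal.primesOver (𝓞 K)).ncard = 1 →
      RecordPolynomial K v l k ((algebraMap (𝓞 K) K).mapMatrix M) ∧
      ∀ [Fact p.Prime],
        ChainNumerals K v l k ((algebraMap (𝓞 K) K).mapMatrix M) (p ^ v.asIdeal.inertiaDeg ℤ)
          ((p ^ v.asIdeal.inertiaDeg ℤ) ^ 3 + 1) ((p ^ v.asIdeal.inertiaDeg ℤ) ^ 4)
          ((p ^ v.asIdeal.inertiaDeg ℤ) ^ 4 + p ^ v.asIdeal.inertiaDeg ℤ)) := by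
  have hv : ((discr K : ℤ) : 𝓞 (maximalRealSubfield K)) ∉ v.asIdeal := by
    intro hmem
    have hunder : (discr K : ℤ) ∈ v.asIdeal.under ℤ := by
      rw [Ideal.under, Ideal.mem_comap, algebraMap_int_eq, eq_intCast]
      exact hmem
    rw [← hvp.over] at hunder
    exact hp (Ideal.mem_span_singleton.mp hunder)
  obtain ⟨h1, h2, h3, h4, h5⟩ := (record_hecke_conductor_outside_discriminant K l k hl M hM hH).2 v hv
  exact ⟨h1, h2, fun ψ hψ hne => h3 vp ψ hψ hne, h4, fun hone => ⟨(h5 hone).1, (h5 hone).2 p⟩⟩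

end Summit.Ventures.HodgeRepro2.T5RecordSatakeConductor
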